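import Literature.NumberTheory.EllipticCurves.IntSeriesNodeTransportNoUnitContent
import Literature.NumberTheory.EllipticCurves.DeShalit1987.KatzMeasureUnitTwistRing
import Mathlib.Tactic
import HarnessLib

set_option autoImplicit false

/-!
# Transport of `𝒪_{ℂ_p}⟦T⟧` along a SHIFTED geometric progression of nodes `w·uᵗ − 1`:
# `F' = (unit)·F`, the ratio `d = u^z` is a one-unit, and `span {F'} = span {F}`

Topic `NumberTheory/EllipticCurves` (receptacle `𝒪_{ℂ_p}⟦T⟧`, values `IntSeries.HasValueAt`). Sequel of
`IntSeriesNodeTransportNoUnitContent.lean` (`map_eq_C_mul_binomPow_mul_of_values_proportional`: nodes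
`uᵗ − 1`, `t ∈ ℕ`, so the node `t = 0` is the ORIGIN `T = 0`). In the interpolation ranges of the
Katz–de Shalit / Müller branches along a `ℤ_p`-line the origin is the TRIVIAL character, which is
never an interpolation point (infinity type `(−m, 0)`, `m ≥ 1`): the natural node families there are
`x_t = r_*(γ)·χ(γ)ᵗ − 1 = w·uᵗ − 1` with `w = r_*(γ)` the node of ONE in-range character `ρ_*` and
`u = χ(γ)` the node of an infinite-order direction `Ψ` (points `ρ_* Ψᵗ`). This file moves such a
family to the origin-based one by the tree's UNIT TWIST `T ↦ w(1+T) − 1` of `𝒪_{ℂ_p}⟦T⟧`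
(`IntSeries.unitTwist`, de Shalit II.4.17 (52); a ring automorphism for `‖w − 1‖ < 1`,
`IntSeries.unitTwistRingHom`, `unitTwist_unitTwist`): `(unitTwist F w)(uᵗ − 1) = F(w uᵗ − 1)`.

* `hasValueAt_unitTwist_pow_sub_one_iff` — the node dictionary just stated.
* `exists_node_value_ne_zero` — a NON-ZERO integral series has a non-zero value at some node
  `w uᵗ − 1` (`u` a one-unit that is not a root of unity): the nodes are infinitely many points of
  the closed disc `‖x‖ ≤ max(‖w − 1‖, ‖u − 1‖) < 1` (identity principle
  `IntSeries.eq_zero_of_infinite_zeros`).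
* **`map_unitTwist_eq_C_mul_binomPow_mul_of_shifted_values_proportional`** — `F, F'` integral,
  values `x_t = F(w uᵗ − 1)`, `x'_t = F'(w uᵗ − 1)` with `x'_t = c·dᵗ·x_t` (`c, d ≠ 0`) for all `t`
  and one `x_{t₀} ≠ 0` ⟹ `∃ z ∈ ℤ_p`, `unitTwist F' w = c·(1+T)^z·unitTwist F w` in `ℂ_p⟦T⟧` and
  `d = u^z`; **`norm_eq_one_of_shifted_values_proportional`** — hence `‖d‖ = 1` (a one-unit: `u^z`
  is one) — the PERIOD-RATIO consequence used by the `ν`-branch rigidity (`c·dᵗ = A^{m_* + m₁t}` for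
  the ratio `A` of two admissible period pairs, so `‖A‖ = 1` WITHOUT any unit-content / `μ = 0`
  input);
* **`span_eq_span_of_shifted_values_proportional`** — if moreover `c ∈ 𝒪_{ℂ_p}ˣ` then
  `Ideal.span {F'} = Ideal.span {F}` in `𝒪_{ℂ_p}⟦T⟧` (untwist by `w⁻¹`; `C c · binomPow z` is a
  unit); `ne_zero_of_shifted_values_proportional` — and `F' ≠ 0`.

USE (cell `bsd-print-cf2`, M-LINE-PIN stub (A) `stub_vLineRestriction` of crux 24086): the
restriction `π_v(G₂)` of a two-variable Katz measure to the `v`-line and Müller's one-variable branch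
`G₁` times the Euler factor at `v̄` take, at the in-range points `ρ_*Ψᵗ` of the line, the SAME
interpolation value at two admissible period pairs; this file turns that into
`span {π_v G₂} = span {E_v̄ · G₁}`. THEOREMS ONLY (no definition, no named fact, no `sorry`).

## References

* F. Q. Gouvêa, *p-adic Numbers*, Universitext, Springer 1993, §5.9 Lemma 5.9.1, Problem 194;
  §5.6 Cor. 5.6.3–5.6.4 (identity principle on a closed subdisc). [Gouvea1993PadicNumbers]
* A. M. Robert, *A Course in p-adic Analysis*, GTM 198, Springer 2000, Ch. V §2.4 Theorem 1,
  Ch. VI §2.1 (Strassman). [Robert2000PadicAnalysis]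
* E. de Shalit, *Iwasawa theory of elliptic curves with complex multiplication* (1987), II.4.17 (52)
  (the unit twist `T ↦ u(1+T) − 1`), II.4.12 Remarks (iii)–(iv) (periods up to units). [deShalit1987]
-/

noncomputable section

open scoped Classical
open Filter Topology PowerSeries Finset
open Literature.NumberTheory.LocalFields

namespace Literature.NumberTheory.EllipticCurves.IntSeries

variable {p : ℕ} [Fact p.Prime]

/-! ### §1. One-units and the shifted nodes `w·uᵗ − 1` -/

/-- A one-unit has norm `1`. [folklore] -/
private theorem sn_norm_eq_one_of_oneUnit {u : ℂ_[p]} (hu : ‖u - 1‖ < 1) : ‖u‖ = 1 := by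
  have hh := IsUltrametricDist.norm_add_eq_max_of_norm_ne_norm (x := u - 1) (y := (1 : ℂ_[p]))
    (by rw [norm_one]; exact hu.ne)
  rw [sub_add_cancel, norm_one] at hh; rw [hh]; exact max_eq_right hu.le

/-- `‖uᵗ − 1‖ ≤ ‖u − 1‖` for a one-unit `u`. [folklore] -/
private theorem sn_norm_pow_sub_one_le {u : ℂ_[p]} (hu : ‖u - 1‖ < 1) (t : ℕ) :
    ‖u ^ t - 1‖ ≤ ‖u - 1‖ := by
  rw [← geom_sum_mul, norm_mul]
  refine mul_le_of_le_one_left (norm_nonneg _) ?_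
  refine IsUltrametricDist.norm_sum_le_of_forall_le_of_nonneg zero_le_one fun i _ ↦ ?_
  rw [norm_pow, sn_norm_eq_one_of_oneUnit hu, one_pow]

/-- **The shifted nodes lie in the closed disc of radius `max(‖w − 1‖, ‖u − 1‖)`**:
`w uᵗ − 1 = (w − 1)uᵗ + (uᵗ − 1)`. [cite: Gouvea1993PadicNumbers, §5.6 Cor. 5.6.4] -/
theorem norm_mul_pow_sub_one_le (w : ℂ_[p]) {u : ℂ_[p]} (hu : ‖u - 1‖ < 1) (t : ℕ) :
    ‖w * u ^ t - 1‖ ≤ max ‖w - 1‖ ‖u - 1‖ := by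
  have h : w * u ^ t - 1 = (w - 1) * u ^ t + (u ^ t - 1) := by ring
  rw [h]
  refine (IsUltrametricDist.norm_add_le_max _ _).trans (max_le_max ?_ (sn_norm_pow_sub_one_le hu t))
  rw [norm_mul, norm_pow, sn_norm_eq_one_of_oneUnit hu, one_pow, mul_one]

/-- The shifted nodes lie in the open unit disc. [cite: Gouvea1993PadicNumbers, §5.6 Cor. 5.6.4] -/
theorem norm_mul_pow_sub_one_lt {w u : ℂ_[p]} (hw : ‖w - 1‖ < 1) (hu : ‖u - 1‖ < 1) (t : ℕ) :
    ‖w * u ^ t - 1‖ < 1 :=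
  (norm_mul_pow_sub_one_le w hu t).trans_lt (max_lt hw hu)

/-- The shifted node family `t ↦ w uᵗ − 1` is injective when `u` is a one-unit which is not a root
of unity and `w` is a one-unit. [cite: Robert2000PadicAnalysis, Ch. VI §2.1] -/
theorem mul_pow_sub_one_injective {w u : ℂ_[p]} (hw : ‖w - 1‖ < 1) (hu : ‖u - 1‖ < 1)
    (hroot : ∀ n : ℕ, 0 < n → u ^ n ≠ 1) :
    Function.Injective fun t : ℕ ↦ w * u ^ t - 1 := by
  have hw0 : w ≠ 0 := norm_pos_iff.mp (by rw [sn_norm_eq_one_of_oneUnit hw]; exact one_pos)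
  have hu0 : u ≠ 0 := norm_pos_iff.mp (by rw [sn_norm_eq_one_of_oneUnit hu]; exact one_pos)
  have key : ∀ s t : ℕ, s < t → u ^ s = u ^ t → False := fun s t hst h ↦ by
    have h1 : u ^ s * u ^ (t - s) = u ^ s * 1 := by
      rw [mul_one, ← pow_add, Nat.add_sub_cancel' hst.le]; exact h.symm
    exact hroot (t - s) (Nat.sub_pos_of_lt hst) (mul_left_cancel₀ (pow_ne_zero s hu0) h1)
  intro s t hst
  have h : u ^ s = u ^ t := mul_left_cancel₀ hw0 (sub_left_injective hst)
  rcases lt_trichotomy s t with hlt | heq | hgt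
  · exact (key s t hlt h).elim
  · exact heq
  · exact (key t s hgt h.symm).elim

/-! ### §2. The unit twist moves the shifted nodes to the origin-based ones -/

/-- **`(unitTwist F w)(uᵗ − 1) = F(w uᵗ − 1)`** (values; `w, u` one-units):
`w(1 + (uᵗ − 1)) − 1 = w uᵗ − 1`. [cite: deShalit1987, II.4.17 (52) (p. 77)] -/
theorem hasValueAt_unitTwist_pow_sub_one_iff (F : PowerSeries (PadicComplexInt p))
    {w : PadicComplexInt p} (hw : ‖(w : ℂ_[p]) - 1‖ < 1) {u : ℂ_[p]} (hu : ‖u - 1‖ < 1) (t : ℕ)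
    (v : ℂ_[p]) :
    IntSeries.HasValueAt (unitTwist F w) (u ^ t - 1) v ↔
      IntSeries.HasValueAt F ((w : ℂ_[p]) * u ^ t - 1) v := by
  have hy : ‖u ^ t - 1‖ < 1 := (sn_norm_pow_sub_one_le hu t).trans_lt hu
  rw [hasValueAt_unitTwist_iff F hw hy]
  have h : (w : ℂ_[p]) * (1 + (u ^ t - 1)) - 1 = (w : ℂ_[p]) * u ^ t - 1 := by ring
  rw [h]

/-- The inverse one-unit: for `‖w − 1‖ < 1` there is `w' ∈ 𝒪_{ℂ_p}` with `w w' = 1` and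
`‖w' − 1‖ < 1` (the one-units form a subgroup of `𝒪_{ℂ_p}ˣ`). [cite: Koblitz1984, Ch. IV §1] -/
theorem exists_mul_eq_one_of_norm_sub_one_lt {w : PadicComplexInt p} (hw : ‖(w : ℂ_[p]) - 1‖ < 1) :
    ∃ w' : PadicComplexInt p, w * w' = 1 ∧ ‖(w' : ℂ_[p]) - 1‖ < 1 := by
  have hunit : IsUnit w := isUnit_padicComplexInt_iff.mpr (sn_norm_eq_one_of_oneUnit hw)
  obtain ⟨wu, hwu⟩ := hunit
  refine ⟨((wu⁻¹ : (PadicComplexInt p)ˣ) : PadicComplexInt p), by rw [← hwu, Units.mul_inv], ?_⟩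
  have hw'1 : ‖(((wu⁻¹ : (PadicComplexInt p)ˣ) : PadicComplexInt p) : ℂ_[p])‖ = 1 :=
    isUnit_padicComplexInt_iff.mp (Units.isUnit _)
  have h1 : (((wu⁻¹ : (PadicComplexInt p)ˣ) : PadicComplexInt p) : ℂ_[p]) * (w : ℂ_[p]) = 1 := by
    rw [← hwu]; norm_cast; simp
  have h2 : (((wu⁻¹ : (PadicComplexInt p)ˣ) : PadicComplexInt p) : ℂ_[p]) - 1 =
      (((wu⁻¹ : (PadicComplexInt p)ˣ) : PadicComplexInt p) : ℂ_[p]) * (1 - (w : ℂ_[p])) := by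
    linear_combination h1
  rw [h2, norm_mul, hw'1, one_mul, norm_sub_rev]; exact hw

/-- Untwisting: `unitTwist (unitTwist F w) w' = F` when `w w' = 1`.
[cite: deShalit1987, II.4.17 (52) (p. 77)] -/
theorem unitTwist_unitTwist_of_mul_eq_one (F : PowerSeries (PadicComplexInt p))
    {w w' : PadicComplexInt p} (hw : ‖(w : ℂ_[p]) - 1‖ < 1) (hw' : ‖(w' : ℂ_[p]) - 1‖ < 1)
    (h : w * w' = 1) : unitTwist (unitTwist F w) w' = F := by
  rw [unitTwist_unitTwist F hw hw', h, unitTwist_one_right]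

/-! ### §3. A non-zero series has a non-zero value at some shifted node -/

/-- **A non-zero integral series does not vanish at all the nodes `w uᵗ − 1`** (`w, u` one-units, `u`
not a root of unity): they are infinitely many points of the closed disc
`‖x‖ ≤ max(‖w − 1‖, ‖u − 1‖) < 1`, where a non-zero bounded series has finitely many zeros.
[cite: Gouvea1993PadicNumbers, §5.6 Cor. 5.6.3 and Cor. 5.6.4] [cite: Robert2000PadicAnalysis, Ch. VI §2.1 Theorem (Strassman)] -/
theorem exists_node_value_ne_zero {F : PowerSeries (PadicComplexInt p)} (hF : F ≠ 0) {w u : ℂ_[p]}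
    (hw : ‖w - 1‖ < 1) (hu : ‖u - 1‖ < 1) (hroot : ∀ n : ℕ, 0 < n → u ^ n ≠ 1) {x : ℕ → ℂ_[p]}
    (hx : ∀ t : ℕ, IntSeries.HasValueAt F (w * u ^ t - 1) (x t)) : ∃ t₀ : ℕ, x t₀ ≠ 0 := by
  by_contra h
  push Not at h
  apply hF
  have hu1 : u - 1 ≠ 0 := fun h0 ↦ hroot 1 one_pos (by rw [pow_one]; exact (sub_eq_zero.mp h0))
  obtain ⟨ϖ, hϖ0, hϖ1, hϖr⟩ :
      ∃ ϖ : ℂ_[p], ϖ ≠ 0 ∧ ‖ϖ‖ < 1 ∧ max ‖w - 1‖ ‖u - 1‖ ≤ ‖ϖ‖ := by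
    by_cases hle : ‖w - 1‖ ≤ ‖u - 1‖
    · exact ⟨u - 1, hu1, hu, max_le hle le_rfl⟩
    · refine ⟨w - 1, fun h0 ↦ hle ?_, hw, max_le le_rfl (not_le.mp hle).le⟩
      rw [h0, norm_zero]; exact norm_nonneg _
  refine eq_zero_of_infinite_zeros hϖ0 hϖ1
    (Set.infinite_of_injective_forall_mem (mul_pow_sub_one_injective hw hu hroot) fun t ↦ ?_)
  refine ⟨(norm_mul_pow_sub_one_le w hu t).trans hϖr, ?_⟩
  have ht := hx t
  rwa [h t] at ht

/-! ### §4. Transport along the shifted nodes -/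

/-- **Proportional values at the shifted nodes force a binomial twist of the unit twists, and the
ratio is a power of the base**: `F, F' ∈ 𝒪_{ℂ_p}⟦T⟧`, `w, u` one-units with `u` not a root of
unity, `c, d ≠ 0`, values `x_t = F(w uᵗ − 1)`, `x'_t = F'(w uᵗ − 1)` with `x'_t = c·dᵗ·x_t` for all
`t ∈ ℕ` and one `x_{t₀} ≠ 0` ⟹ for some `z ∈ ℤ_p`: `unitTwist F' w = c·(1+T)^z·unitTwist F w` in
`ℂ_p⟦T⟧` and `d = u^z`. [cite: Gouvea1993PadicNumbers, §5.9 Lemma 5.9.1 (converse) and Problem 194]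
[cite: Robert2000PadicAnalysis, Ch. V §2.4 Theorem 1] [cite: deShalit1987, II.4.17 (52) (p. 77)] -/
theorem map_unitTwist_eq_C_mul_binomPow_mul_of_shifted_values_proportional
    {F F' : PowerSeries (PadicComplexInt p)} {w : PadicComplexInt p} {u c d : ℂ_[p]}
    {x x' : ℕ → ℂ_[p]} (hw : ‖(w : ℂ_[p]) - 1‖ < 1) (hu : ‖u - 1‖ < 1)
    (hroot : ∀ n : ℕ, 0 < n → u ^ n ≠ 1) (hc : c ≠ 0) (hd : d ≠ 0)
    (hx : ∀ t : ℕ, IntSeries.HasValueAt F ((w : ℂ_[p]) * u ^ t - 1) (x t))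
    (hx' : ∀ t : ℕ, IntSeries.HasValueAt F' ((w : ℂ_[p]) * u ^ t - 1) (x' t))
    (hrel : ∀ t : ℕ, x' t = c * d ^ t * x t) {t₀ : ℕ} (h0 : x t₀ ≠ 0) :
    ∃ z : ℤ_[p],
      (unitTwist F' w).map (PadicComplexInt p).toSubring.subtype =
        C c * (binomPow z).map (PadicComplexInt p).toSubring.subtype *
          (unitTwist F w).map (PadicComplexInt p).toSubring.subtype ∧
      d = onePlusPow z (u - 1) :=
  map_eq_C_mul_binomPow_mul_of_values_proportional hu hroot hc hd
    (fun t ↦ (hasValueAt_unitTwist_pow_sub_one_iff F hw hu t _).mpr (hx t))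
    (fun t ↦ (hasValueAt_unitTwist_pow_sub_one_iff F' hw hu t _).mpr (hx' t)) hrel h0

/-- **The ratio `d` is a one-unit; in particular `‖d‖ = 1`.** In the setting of
`map_unitTwist_eq_C_mul_binomPow_mul_of_shifted_values_proportional`, `d = u^z` with
`‖u^z − 1‖ ≤ ‖u − 1‖ < 1`. (For two Katz–de Shalit branches at two admissible period pairs,
`c·dᵗ = A^{m_* + m₁ t}` with `A` the period ratio, so `‖A‖ = 1`: de Shalit's "`Ω`, `Ω_p` are
determined up to units".) [cite: deShalit1987, II.4.12 Remarks (iii)–(iv) (p. 66–67)]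
[cite: Gouvea1993PadicNumbers, §5.9 Problem 194] -/
theorem norm_sub_one_lt_one_of_shifted_values_proportional
    {F F' : PowerSeries (PadicComplexInt p)} {w : PadicComplexInt p} {u c d : ℂ_[p]}
    {x x' : ℕ → ℂ_[p]} (hw : ‖(w : ℂ_[p]) - 1‖ < 1) (hu : ‖u - 1‖ < 1)
    (hroot : ∀ n : ℕ, 0 < n → u ^ n ≠ 1) (hc : c ≠ 0) (hd : d ≠ 0)
    (hx : ∀ t : ℕ, IntSeries.HasValueAt F ((w : ℂ_[p]) * u ^ t - 1) (x t))
    (hx' : ∀ t : ℕ, IntSeries.HasValueAt F' ((w : ℂ_[p]) * u ^ t - 1) (x' t))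
    (hrel : ∀ t : ℕ, x' t = c * d ^ t * x t) {t₀ : ℕ} (h0 : x t₀ ≠ 0) : ‖d - 1‖ < 1 := by
  obtain ⟨z, -, hdz⟩ :=
    map_unitTwist_eq_C_mul_binomPow_mul_of_shifted_values_proportional hw hu hroot hc hd hx hx' hrel h0
  rw [hdz]
  exact (norm_onePlusPow_sub_one_le z hu).trans_lt hu

/-- `‖d‖ = 1` in the same setting. [cite: deShalit1987, II.4.12 Remarks (iii)–(iv) (p. 66–67)] -/
theorem norm_eq_one_of_shifted_values_proportional
    {F F' : PowerSeries (PadicComplexInt p)} {w : PadicComplexInt p} {u c d : ℂ_[p]}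
    {x x' : ℕ → ℂ_[p]} (hw : ‖(w : ℂ_[p]) - 1‖ < 1) (hu : ‖u - 1‖ < 1)
    (hroot : ∀ n : ℕ, 0 < n → u ^ n ≠ 1) (hc : c ≠ 0) (hd : d ≠ 0)
    (hx : ∀ t : ℕ, IntSeries.HasValueAt F ((w : ℂ_[p]) * u ^ t - 1) (x t))
    (hx' : ∀ t : ℕ, IntSeries.HasValueAt F' ((w : ℂ_[p]) * u ^ t - 1) (x' t))
    (hrel : ∀ t : ℕ, x' t = c * d ^ t * x t) {t₀ : ℕ} (h0 : x t₀ ≠ 0) : ‖d‖ = 1 :=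
  sn_norm_eq_one_of_oneUnit
    (norm_sub_one_lt_one_of_shifted_values_proportional hw hu hroot hc hd hx hx' hrel h0)

/-- **Integral constant: the identity between the unit twists in `𝒪_{ℂ_p}⟦T⟧`.**
[cite: Gouvea1993PadicNumbers, §5.9 Lemma 5.9.1 (converse) and Problem 194] [cite: deShalit1987, II.4.17 (52) (p. 77)] -/
theorem unitTwist_eq_C_mul_binomPow_mul_of_shifted_values_proportional
    {F F' : PowerSeries (PadicComplexInt p)} {w c : PadicComplexInt p} {u d : ℂ_[p]}
    {x x' : ℕ → ℂ_[p]} (hw : ‖(w : ℂ_[p]) - 1‖ < 1) (hu : ‖u - 1‖ < 1)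
    (hroot : ∀ n : ℕ, 0 < n → u ^ n ≠ 1) (hc : (c : ℂ_[p]) ≠ 0) (hd : d ≠ 0)
    (hx : ∀ t : ℕ, IntSeries.HasValueAt F ((w : ℂ_[p]) * u ^ t - 1) (x t))
    (hx' : ∀ t : ℕ, IntSeries.HasValueAt F' ((w : ℂ_[p]) * u ^ t - 1) (x' t))
    (hrel : ∀ t : ℕ, x' t = (c : ℂ_[p]) * d ^ t * x t) {t₀ : ℕ} (h0 : x t₀ ≠ 0) :
    ∃ z : ℤ_[p], unitTwist F' w = C c * binomPow z * unitTwist F w ∧ d = onePlusPow z (u - 1) :=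
  eq_C_mul_binomPow_mul_of_values_proportional hu hroot hc hd
    (fun t ↦ (hasValueAt_unitTwist_pow_sub_one_iff F hw hu t _).mpr (hx t))
    (fun t ↦ (hasValueAt_unitTwist_pow_sub_one_iff F' hw hu t _).mpr (hx' t)) hrel h0

/-- **Untwisted: `F' = U·F` with `U` a unit of `𝒪_{ℂ_p}⟦T⟧`** when the constant `c` is a unit of
`𝒪_{ℂ_p}` (`U = unitTwist (C c · (1+T)^z) w'`, `w w' = 1`).
[cite: Gouvea1993PadicNumbers, §5.9 Lemma 5.9.1 (converse) and Problem 194] [cite: deShalit1987, II.4.17 (52) (p. 77)] -/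
theorem exists_isUnit_eq_mul_of_shifted_values_proportional
    {F F' : PowerSeries (PadicComplexInt p)} {w c : PadicComplexInt p} {u d : ℂ_[p]}
    {x x' : ℕ → ℂ_[p]} (hw : ‖(w : ℂ_[p]) - 1‖ < 1) (hu : ‖u - 1‖ < 1)
    (hroot : ∀ n : ℕ, 0 < n → u ^ n ≠ 1) (hcu : IsUnit c) (hd : d ≠ 0)
    (hx : ∀ t : ℕ, IntSeries.HasValueAt F ((w : ℂ_[p]) * u ^ t - 1) (x t))
    (hx' : ∀ t : ℕ, IntSeries.HasValueAt F' ((w : ℂ_[p]) * u ^ t - 1) (x' t))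
    (hrel : ∀ t : ℕ, x' t = (c : ℂ_[p]) * d ^ t * x t) {t₀ : ℕ} (h0 : x t₀ ≠ 0) :
    ∃ U : PowerSeries (PadicComplexInt p), IsUnit U ∧ F' = U * F := by
  have hc : (c : ℂ_[p]) ≠ 0 :=
    norm_pos_iff.mp (by rw [isUnit_padicComplexInt_iff.mp hcu]; exact one_pos)
  obtain ⟨z, hz, -⟩ :=
    unitTwist_eq_C_mul_binomPow_mul_of_shifted_values_proportional hw hu hroot hc hd hx hx' hrel h0
  obtain ⟨w', hww', hw'⟩ := exists_mul_eq_one_of_norm_sub_one_lt hw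
  refine ⟨unitTwist (C c * binomPow z) w', ?_, ?_⟩
  · have h1 : IsUnit (C c * binomPow z : PowerSeries (PadicComplexInt p)) := by
      refine (hcu.map (C (R := PadicComplexInt p))).mul ?_
      exact PowerSeries.isUnit_iff_constantCoeff.mpr (by rw [constantCoeff_binomPow]; exact isUnit_one)
    exact h1.map (unitTwistRingHom w' hw')
  · have h := congrArg (fun Q : PowerSeries (PadicComplexInt p) ↦ unitTwist Q w') hz
    rw [unitTwist_unitTwist_of_mul_eq_one F' hw hw' hww', unitTwist_mul _ _ hw',
      unitTwist_unitTwist_of_mul_eq_one F hw hw' hww'] at h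
    exact h

/-- **`Ideal.span {F'} = Ideal.span {F}` in `𝒪_{ℂ_p}⟦T⟧`** when the constant `c` is a unit of
`𝒪_{ℂ_p}` — the shape in which a characteristic-ideal clause `I = span {G}` is transported between
two branches at two admissible period pairs.
[cite: deShalit1987, II.4.12 Remarks (iii)–(iv) (p. 66–67)] [cite: Gouvea1993PadicNumbers, §5.9 Problem 194] -/
theorem span_eq_span_of_shifted_values_proportional
    {F F' : PowerSeries (PadicComplexInt p)} {w c : PadicComplexInt p} {u d : ℂ_[p]}
    {x x' : ℕ → ℂ_[p]} (hw : ‖(w : ℂ_[p]) - 1‖ < 1) (hu : ‖u - 1‖ < 1)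
    (hroot : ∀ n : ℕ, 0 < n → u ^ n ≠ 1) (hcu : IsUnit c) (hd : d ≠ 0)
    (hx : ∀ t : ℕ, IntSeries.HasValueAt F ((w : ℂ_[p]) * u ^ t - 1) (x t))
    (hx' : ∀ t : ℕ, IntSeries.HasValueAt F' ((w : ℂ_[p]) * u ^ t - 1) (x' t))
    (hrel : ∀ t : ℕ, x' t = (c : ℂ_[p]) * d ^ t * x t) {t₀ : ℕ} (h0 : x t₀ ≠ 0) :
    Ideal.span ({F'} : Set (PowerSeries (PadicComplexInt p))) = Ideal.span {F} := by
  obtain ⟨U, hU, hF'⟩ :=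
    exists_isUnit_eq_mul_of_shifted_values_proportional hw hu hroot hcu hd hx hx' hrel h0
  refine (Ideal.span_singleton_eq_span_singleton.mpr ⟨hU.unit, ?_⟩).symm
  rw [IsUnit.unit_spec, mul_comm, ← hF']

/-- **`F' ≠ 0`** as soon as one node value of `F` is non-zero (no twist needed: `x'_{t₀} =
c d^{t₀} x_{t₀} ≠ 0` is a value of `F'`). [cite: Gouvea1993PadicNumbers, §5.6 Cor. 5.6.4] -/
theorem ne_zero_of_shifted_values_proportional
    {F' : PowerSeries (PadicComplexInt p)} {w u c d : ℂ_[p]} {x x' : ℕ → ℂ_[p]}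
    (hc : c ≠ 0) (hd : d ≠ 0) (hx' : ∀ t : ℕ, IntSeries.HasValueAt F' (w * u ^ t - 1) (x' t))
    (hrel : ∀ t : ℕ, x' t = c * d ^ t * x t) {t₀ : ℕ} (h0 : x t₀ ≠ 0) : F' ≠ 0 := by
  intro hF'
  have h1 : x' t₀ = 0 := by
    have h := hx' t₀
    rw [hF'] at h
    have hz : IntSeries.HasValueAt (0 : PowerSeries (PadicComplexInt p)) (w * u ^ t₀ - 1) 0 := by
      unfold IntSeries.HasValueAt; simp
    exact HasSum.unique h hz
  exact (mul_ne_zero (mul_ne_zero hc (pow_ne_zero _ hd)) h0) (by rw [← hrel]; exact h1)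

end Literature.NumberTheory.EllipticCurves.IntSeries

end
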